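import Mathlib.FieldTheory.IsAlgClosed.Classification
import Mathlib.NumberTheory.Padics.Complex
import Mathlib.Analysis.Complex.Cardinality
import Mathlib.Analysis.Complex.Polynomial.Basic
import Mathlib.Topology.Algebra.Module.Cardinality
import Mathlib.RingTheory.Algebraic.Cardinality
import HarnessLib

/-!
# `ℚ̄_p` and `ℂ` are isomorphic as abstract fields (Steinitz; the "Lefschetz principle" for `ℚ̄_p`)

Topic `FieldTheory/AlgClosed` (namespace `Literature.FieldTheory.AlgClosed`). Everything here is
PROVED; no definitions, no named facts.

Steinitz' classification (Mathlib `IsAlgClosed.ringEquiv_of_equiv_of_charZero`: two uncountable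
algebraically closed fields of characteristic `0` with the same cardinality are isomorphic) applied
to `ℚ̄_p = PadicAlgCl p` (Mathlib: the algebraic closure of `ℚ_p`) and `ℂ`, both of cardinality
`𝔠`:

* `Cardinal.mk_padic` — `#ℚ_p = 𝔠` (`≤`: `ℚ_p` is a quotient of the Cauchy sequences of rationals,
  exactly as Mathlib's `Cardinal.mk_real`; `≥`: Mathlib's
  `continuum_le_cardinal_of_nontriviallyNormedField`);
* `Cardinal.mk_padicAlgCl` — `#ℚ̄_p = 𝔠` (an algebraic extension of an infinite field has the same
  cardinality, Mathlib `Algebra.IsAlgebraic.cardinalMk_le_max`);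
* `PadicAlgCl.nonempty_ringEquiv_complex` — `Nonempty (PadicAlgCl p ≃+* ℂ)`.

Use: transport of purely ALGEBRAIC theorems proved in the tree over `ℂ` (e.g. zero estimates on
commutative algebraic groups, `Literature.NumberTheory.Transcendental.Philippon1986_GaGm_holds`) to
`ℚ̄_p`, where the `p`-adic transcendence proofs need them (Roy 1992, Thm 1 for `K = ℂ_p`). The
isomorphism is of course neither continuous nor canonical.

## References

* E. Steinitz, *Algebraische Theorie der Körper*, J. reine angew. Math. 137 (1910), 167–309
  (classification of algebraically closed fields by characteristic and transcendence degree).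
* A. M. Robert, *A Course in p-adic Analysis*, GTM 198, Springer 2000, Ch. 3, §3.3–3.4
  (`ℂ_p` and `ℂ` are isomorphic as fields). [folklore]
-/

noncomputable section

open Cardinal

universe u

namespace Literature.FieldTheory.AlgClosed

/-- **`#ℚ_p = 𝔠`.** [folklore] -/
theorem _root_.Cardinal.mk_padic (p : ℕ) [Fact p.Prime] : #ℚ_[p] = 𝔠 := by
  apply le_antisymm
  · -- `ℚ_p` is a quotient of a subtype of `ℕ → ℚ`
    change #(Quotient (CauSeq.equiv : Setoid (CauSeq ℚ (padicNorm p)))) ≤ 𝔠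
    refine (mk_quotient_le (s := (CauSeq.equiv : Setoid (CauSeq ℚ (padicNorm p))))).trans ?_
    refine (mk_subtype_le _).trans_eq ?_
    rw [← power_def, mk_nat, Cardinal.mkRat, aleph0_power_aleph0]
  · exact continuum_le_cardinal_of_nontriviallyNormedField ℚ_[p]

/-- **`#ℚ̄_p = 𝔠`** (`ℚ̄_p = PadicAlgCl p`, the algebraic closure of `ℚ_p`). [folklore] -/
theorem _root_.Cardinal.mk_padicAlgCl (p : ℕ) [Fact p.Prime] : #(PadicAlgCl p) = 𝔠 := by
  apply le_antisymm
  · refine (Algebra.IsAlgebraic.cardinalMk_le_max ℚ_[p] (PadicAlgCl p)).trans ?_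
    rw [Cardinal.mk_padic, max_eq_left aleph0_le_continuum]
  · rw [← Cardinal.mk_padic p]
    exact mk_le_of_injective (algebraMap ℚ_[p] (PadicAlgCl p)).injective

/-- **`ℚ̄_p ≃ ℂ` as abstract fields** (Steinitz): both are algebraically closed of characteristic `0`
and cardinality `𝔠`. [folklore] -/
theorem _root_.PadicAlgCl.nonempty_ringEquiv_complex (p : ℕ) [Fact p.Prime] :
    Nonempty (PadicAlgCl p ≃+* ℂ) := by
  refine IsAlgClosed.ringEquiv_of_equiv_of_charZero ?_
    (Cardinal.eq.1 (by rw [Cardinal.mk_padicAlgCl, Cardinal.mk_complex]))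
  rw [Cardinal.mk_padicAlgCl]
  exact aleph0_lt_continuum

/-- The same with `ℂ` on the left. [folklore] -/
theorem _root_.Complex.nonempty_ringEquiv_padicAlgCl (p : ℕ) [Fact p.Prime] :
    Nonempty (ℂ ≃+* PadicAlgCl p) :=
  (PadicAlgCl.nonempty_ringEquiv_complex p).map RingEquiv.symm

end Literature.FieldTheory.AlgClosed
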